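import Summits.KontsevichZagierPeriods.KontsevichZagierPeriods.Theses.IsogenyCertificates
import Summits.KontsevichZagierPeriods.KontsevichZagierPeriods.Theorems.HermiteRigidityGenusTwoCycleTransferPushforwardDimOne

/-!
# One-sheet transfer along the x-map of an isogeny (route IsogenyCertificates)

Support for item stmt-KontsevichZagierPeriods-6744 (`ThirtySevenIsogenyCalibration`) and, more
generally, for the cruxes `XMapPeriodTransfer` / `EffectiveXMapChains`: the case of the x-map of an
isogeny between curves with ONE real component (`4A³ + 27B² > 0`) which has no pole and no critical
point on `{P > 0}` — e.g. the dual of an isogeny whose kernel is the real circle `E(ℝ)[ℓ]`. Then the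
whole transfer `[{P > 0}, b|c|/√P] ~ [{P' > 0}, b/√P']` is ONE instance of Kontsevich–Zagier's
rule (2).

* Part A: a real cubic `t³ + At + B` with `4A³ + 27B² > 0` has exactly one real root `ρ`
  (`cubic_exists_root`, `cubic_eq_zero_iff`) and `{t | 0 < t³ + At + B} = (ρ, ∞)` (`cubic_pos_iff`);
  elementary (`4A³ + 27B² = (3ρ² + 4A)(3ρ² + A)²`), no `Polynomial.roots`.
* Part B: `transfer_mem_changeOfVariablesRel`. Given `U, g, S ∈ ℝ[X]`, `c ≠ 0` with the pulled-back
  curve equation `U³ + A'Ug⁴ + B'g⁶ = S²·(X³ + AX + B)` (Silverman AEC III.4, standard form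
  `(U/g², yS/g³)`) and the normalisation `c·S = U'g − 2Ug'`, and a half-line `[t₀, ∞) ⊇ {P > 0}`
  on which `g > 0`, `S ≠ 0`: the x-map `R = U/g²` satisfies `R' = cS/g³`, `P'(R) = S²P/g⁶`, maps
  `(ρ, ∞)` into `(ρ', ∞)` with `R(ρ) = ρ'`, is injective there (Rolle) and onto (intermediate
  values + `R → +∞`), and the rule-2 Jacobian identity `b|c|/√P = (b/√(P'∘R))·|R'|` holds; so
  `[r] − [r']` IS an element of `KZ.changeOfVariablesRel` (`Φ = R`, `Φ' = R'·id` on `ℝ¹`).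

The certificate layer (integer coefficient lists checked by the kernel) is in
`IsogenyCertificatesOneSheetListCert`; the 37-isogeny instance in
`IsogenyCertificatesThirtySevenIsogenyCalibration`.

References: M. Kontsevich, D. Zagier, *Periods* (2001), §1.2 rule (2); J. H. Silverman,
*The Arithmetic of Elliptic Curves* (2009), III.4 (standard form of an isogeny, invariant
differential); J. Vélu, C. R. Acad. Sci. Paris 273 (1971).
-/

noncomputable section

open Set Filter Polynomial
open Literature.NumberTheory.Transcendental Literature.ModelTheory.ExponentialFields
open Summit.KontsevichZagierPeriods.HermiteRigidity.GenusTwoCycleTransfer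
  (det_smul_id_fin_one hasFDerivAt_fin_one)

namespace Summit.KontsevichZagierPeriods.IsogenyCertificates.OneSheetTransfer

/-! ### Part A: real cubics with one real root -/

/-- `t³ + A t + B = (t − ρ)(t² + ρ t + ρ² + A)` for a root `ρ`. [folklore] -/
theorem cubic_factor {A B ρ : ℝ} (hρ : ρ ^ 3 + A * ρ + B = 0) (t : ℝ) :
    t ^ 3 + A * t + B = (t - ρ) * (t ^ 2 + ρ * t + (ρ ^ 2 + A)) := by
  have hB : B = -ρ ^ 3 - A * ρ := by linarith
  subst hB
  ring

/-- `4A³ + 27B² = (3ρ² + 4A)(3ρ² + A)²` for a root `ρ` of `t³ + A t + B`. [folklore] -/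
theorem discr_factor {A B ρ : ℝ} (hρ : ρ ^ 3 + A * ρ + B = 0) :
    4 * A ^ 3 + 27 * B ^ 2 = (3 * ρ ^ 2 + 4 * A) * (3 * ρ ^ 2 + A) ^ 2 := by
  have hB : B = -ρ ^ 3 - A * ρ := by linarith
  subst hB
  ring

/-- If `4A³ + 27B² > 0` the quadratic cofactor at a real root is positive definite. [folklore] -/
theorem cofactor_pos {A B ρ : ℝ} (hρ : ρ ^ 3 + A * ρ + B = 0) (hΔ : 0 < 4 * A ^ 3 + 27 * B ^ 2)
    (t : ℝ) : 0 < t ^ 2 + ρ * t + (ρ ^ 2 + A) := by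
  have h1 : 0 < 3 * ρ ^ 2 + 4 * A := by
    by_contra h
    push Not at h
    rw [discr_factor hρ] at hΔ
    nlinarith [sq_nonneg (3 * ρ ^ 2 + A)]
  nlinarith [sq_nonneg (2 * t + ρ)]

/-- If `4A³ + 27B² > 0` and `ρ` is a real root, `{P > 0} = (ρ, ∞)`. [folklore] -/
theorem cubic_pos_iff {A B ρ : ℝ} (hρ : ρ ^ 3 + A * ρ + B = 0) (hΔ : 0 < 4 * A ^ 3 + 27 * B ^ 2)
    (t : ℝ) : 0 < t ^ 3 + A * t + B ↔ ρ < t := by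
  rw [cubic_factor hρ t]
  have hq := cofactor_pos hρ hΔ t
  constructor
  · intro h
    by_contra hle
    push Not at hle
    nlinarith [mul_nonneg (sub_nonneg.mpr hle) hq.le]
  · intro h
    exact mul_pos (sub_pos.mpr h) hq

/-- If `4A³ + 27B² > 0` the real root is unique. [folklore] -/
theorem cubic_eq_zero_iff {A B ρ : ℝ} (hρ : ρ ^ 3 + A * ρ + B = 0)
    (hΔ : 0 < 4 * A ^ 3 + 27 * B ^ 2) (t : ℝ) : t ^ 3 + A * t + B = 0 ↔ t = ρ := by
  rw [cubic_factor hρ t, mul_eq_zero, sub_eq_zero, or_iff_left (cofactor_pos hρ hΔ t).ne']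

/-- A real cubic `t³ + A t + B` has a real root (intermediate value theorem on `[−M, M]`,
`M = |A| + |B| + 1`). [folklore] -/
theorem cubic_exists_root (A B : ℝ) : ∃ ρ : ℝ, ρ ^ 3 + A * ρ + B = 0 := by
  set M : ℝ := |A| + |B| + 1 with hM
  have hA := abs_nonneg A
  have hB := abs_nonneg B
  have hM1 : 1 ≤ M := by linarith
  have hcont : ContinuousOn (fun t : ℝ => t ^ 3 + A * t + B) (Icc (-M) M) := by fun_prop
  have h3 : M ^ 2 ≤ M ^ 3 := by nlinarith
  have hAM : |A * M| ≤ (M - 1) * M := by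
    rw [abs_mul, abs_of_pos (by linarith : (0 : ℝ) < M)]
    nlinarith
  have hBM : |B| ≤ M - 1 := by linarith
  have hneg : (-M) ^ 3 = -M ^ 3 := by ring
  have hmul : A * -M = -(A * M) := by ring
  have hlo : (-M) ^ 3 + A * (-M) + B ≤ 0 := by
    have h1 := neg_abs_le (A * M)
    have h2 := le_abs_self B
    linarith
  have hhi : 0 ≤ M ^ 3 + A * M + B := by
    have h1 := neg_abs_le (A * M)
    have h2 := neg_abs_le B
    linarith
  obtain ⟨ρ, -, hρ⟩ := intermediate_value_Icc (by linarith : -M ≤ M) hcont ⟨hlo, hhi⟩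
  exact ⟨ρ, hρ⟩

/-! ### Part B: one sheet is one move of rule (2) -/

/-- **One-sheet transfer.** Let `U, g, S ∈ ℝ[X]` and `c ≠ 0` satisfy the pulled-back curve
equation `U³ + A'Ug⁴ + B'g⁶ = S²·(X³ + AX + B)` and the normalisation `c·S = U'g − 2Ug'` (so that
`R = U/g²` has `R' = cS/g³` and `c²·P'(R) = P·R'²`), with both cubics of negative discriminant
(`4A³ + 27B² > 0`: one real component). If `g > 0` and `S ≠ 0` on a half-line `[t₀, ∞)` with
`P(t₀) ≤ 0` and `deg g² < deg U` with positive ratio of leading coefficients, then `R` maps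
`{P > 0}` real-analytically and bijectively onto `{P' > 0}` and, for every real `b`,
`[{P > 0}, b|c|/√P] − [{P' > 0}, b/√P']` is ONE change-of-variables relation of the
Kontsevich–Zagier calculus (`Φ = R`, `|Φ'| = |c||S|/g³`, `√(P'∘R) = |S|√P/g³`).
[cite: KontsevichZagier2001, §1.2 rule (2)] -/
theorem transfer_mem_changeOfVariablesRel {A B A' B' c t₀ : ℝ} {U g S : ℝ[X]}
    (hΔ : 0 < 4 * A ^ 3 + 27 * B ^ 2) (hΔ' : 0 < 4 * A' ^ 3 + 27 * B' ^ 2) (hc : c ≠ 0)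
    (hid : ∀ x : ℝ, (U.eval x) ^ 3 + A' * U.eval x * (g.eval x) ^ 4 + B' * (g.eval x) ^ 6 =
      (S.eval x) ^ 2 * (x ^ 3 + A * x + B))
    (hnorm : ∀ x : ℝ, c * S.eval x =
      (derivative U).eval x * g.eval x - 2 * U.eval x * (derivative g).eval x)
    (ht₀ : t₀ ^ 3 + A * t₀ + B ≤ 0) (hg : ∀ x, t₀ ≤ x → 0 < g.eval x)
    (hS : ∀ x, t₀ ≤ x → S.eval x ≠ 0)
    (hdeg : (g ^ 2).degree < U.degree) (hlead : 0 < U.leadingCoeff / (g ^ 2).leadingCoeff)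
    (hΦ : IsSemialgebraicMapOn ℚ {p : Fin 1 → ℝ | 0 < p 0 ^ 3 + A * p 0 + B}
      (fun (p : Fin 1 → ℝ) (_ : Fin 1) => U.eval (p 0) / (g.eval (p 0)) ^ 2))
    (b : ℝ) (r r' : KZ.IntegralRep 1)
    (h1 : r.domain = {x | 0 < x 0 ^ 3 + A * x 0 + B})
    (h2 : EqOn r.integrand (fun x => b * |c| / Real.sqrt (x 0 ^ 3 + A * x 0 + B)) r.domain)
    (h3 : r'.domain = {x | 0 < x 0 ^ 3 + A' * x 0 + B'})
    (h4 : EqOn r'.integrand (fun x => b / Real.sqrt (x 0 ^ 3 + A' * x 0 + B')) r'.domain) :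
    KZ.of r - KZ.of r' ∈ KZ.changeOfVariablesRel := by
  -- the real roots of the two cubics
  obtain ⟨ρ, hρ⟩ := cubic_exists_root A B
  obtain ⟨ρ', hρ'⟩ := cubic_exists_root A' B'
  have hPiff := cubic_pos_iff hρ hΔ
  have hP'iff := cubic_pos_iff hρ' hΔ'
  have ht₀ρ : t₀ ≤ ρ := by
    by_contra h
    push Not at h
    exact absurd ((hPiff t₀).mpr h) (not_lt.mpr ht₀)
  have hgρ : ∀ x, ρ ≤ x → 0 < g.eval x := fun x hx => hg x (ht₀ρ.trans hx)
  have hSρ : ∀ x, ρ ≤ x → S.eval x ≠ 0 := fun x hx => hS x (ht₀ρ.trans hx)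
  -- the x-map and its derivative
  set R : ℝ → ℝ := fun x => U.eval x / (g.eval x) ^ 2 with hR
  have hRderiv : ∀ x, ρ ≤ x → HasDerivAt R (c * S.eval x / (g.eval x) ^ 3) x := by
    intro x hx
    have hgx := (hgρ x hx).ne'
    have hU := U.hasDerivAt x
    have hg2 : HasDerivAt (fun y => (g.eval y) ^ 2) (2 * g.eval x * (derivative g).eval x) x := by
      have h := (g.hasDerivAt x).pow 2
      simp only [Nat.cast_ofNat, Nat.reduceSub, pow_one] at h
      exact h
    have hdiv : HasDerivAt (fun y => U.eval y / (g.eval y) ^ 2)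
        (((derivative U).eval x * (g.eval x) ^ 2 - U.eval x * (2 * g.eval x * (derivative g).eval x))
          / ((g.eval x) ^ 2) ^ 2) x := hU.div hg2 (pow_ne_zero 2 hgx)
    refine hdiv.congr_deriv ?_
    rw [hnorm x]
    field_simp
  -- `P' (R x)` in terms of `x`
  have hP'R : ∀ x, g.eval x ≠ 0 →
      R x ^ 3 + A' * R x + B' = (S.eval x) ^ 2 * (x ^ 3 + A * x + B) / (g.eval x) ^ 6 := by
    intro x hgx
    have key : (U.eval x / g.eval x ^ 2) ^ 3 + A' * (U.eval x / g.eval x ^ 2) + B' =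
        ((U.eval x) ^ 3 + A' * U.eval x * (g.eval x) ^ 4 + B' * (g.eval x) ^ 6) / (g.eval x) ^ 6 := by
      field_simp
    simp only [hR]
    rw [key, hid x]
  -- `R` maps `{P > 0}` into `{P' > 0}`
  have hinto : ∀ x, ρ < x → ρ' < R x := by
    intro x hx
    have hPx : 0 < x ^ 3 + A * x + B := (hPiff x).mpr hx
    have hgx := hgρ x hx.le
    have hSx := hSρ x hx.le
    have hpos : 0 < R x ^ 3 + A' * R x + B' := by
      rw [hP'R x hgx.ne']
      positivity
    exact (hP'iff _).mp hpos
  -- `R ρ = ρ'`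
  have hRρ : R ρ = ρ' := by
    have h := hP'R ρ (hgρ ρ le_rfl).ne'
    rw [hρ, mul_zero, zero_div] at h
    exact (cubic_eq_zero_iff hρ' hΔ' _).mp h
  -- continuity on `[ρ, ∞)` and growth at `+∞`
  have hRcont : ContinuousOn R (Ici ρ) := by
    refine ContinuousOn.div U.continuous.continuousOn (g.continuous.pow 2).continuousOn ?_
    intro x hx
    exact pow_ne_zero 2 (hgρ x hx).ne'
  have hRtop : Tendsto R atTop atTop := by
    have h := Polynomial.div_tendsto_atTop_of_degree_gt' U (g ^ 2) hdeg hlead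
    exact h.congr fun x => by simp [hR, eval_pow]
  -- surjectivity onto `(ρ', ∞)`
  have hsurj : ∀ X, ρ' < X → ∃ x, ρ < x ∧ R x = X := by
    intro X hX
    obtain ⟨M, hM⟩ := Filter.eventually_atTop.mp (hRtop.eventually_gt_atTop X)
    have hρM : ρ ≤ max M (ρ + 1) := by linarith [le_max_right M (ρ + 1)]
    have hXM : X < R (max M (ρ + 1)) := hM _ (le_max_left _ _)
    have hcont : ContinuousOn R (Icc ρ (max M (ρ + 1))) := hRcont.mono Icc_subset_Ici_self
    obtain ⟨x, hx, hxX⟩ :=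
      intermediate_value_Icc hρM hcont ⟨by rw [hRρ]; exact hX.le, hXM.le⟩
    refine ⟨x, ?_, hxX⟩
    rcases eq_or_lt_of_le hx.1 with h | h
    · rw [← h, hRρ] at hxX
      linarith
    · exact h
  -- injectivity on `(ρ, ∞)` (Rolle)
  have hkey : ∀ x y, ρ < x → x < y → R x = R y → False := by
    intro x y hx hxy hRxy
    obtain ⟨z, hz, hz0⟩ := exists_hasDerivAt_eq_zero hxy
      (hRcont.mono fun t ht => (hx.le.trans ht.1 : ρ ≤ t)) hRxy
      (fun t ht => hRderiv t (hx.le.trans ht.1.le))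
    have h1 := hSρ z (hx.le.trans hz.1.le)
    have h2 := (hgρ z (hx.le.trans hz.1.le)).ne'
    rw [div_eq_zero_iff, mul_eq_zero] at hz0
    rcases hz0 with (h | h) | h
    · exact hc h
    · exact h1 h
    · exact pow_ne_zero 3 h2 h
  have hinj : ∀ x y, ρ < x → ρ < y → R x = R y → x = y := by
    intro x y hx hy hxy
    by_contra hne
    rcases lt_or_gt_of_ne hne with hlt | hlt
    · exact hkey x y hx hlt hxy
    · exact hkey y x hy hlt hxy.symm
  -- the move
  refine ⟨1, r, r', fun p _ => R (p 0),
    fun p => (c * S.eval (p 0) / (g.eval (p 0)) ^ 3) • ContinuousLinearMap.id ℝ (Fin 1 → ℝ),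
    ?_, ?_, ?_, ?_, ?_, rfl⟩
  · -- `Φ` is `ℚ`-semialgebraic on the domain
    rw [h1]
    exact hΦ
  · -- derivative within the domain
    intro p hp
    rw [h1] at hp
    have hp' : ρ < p 0 := (hPiff _).mp hp
    exact (hasFDerivAt_fin_one R _ p (hRderiv (p 0) hp'.le)).hasFDerivWithinAt
  · -- injectivity
    intro p hp q hq hpq
    rw [h1] at hp hq
    have h0 : R (p 0) = R (q 0) := congrFun hpq 0
    have hpq0 := hinj _ _ ((hPiff _).mp hp) ((hPiff _).mp hq) h0
    funext i
    rw [Fin.fin_one_eq_zero i]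
    exact hpq0
  · -- the image is `{P' > 0}`
    rw [h1, h3]
    ext X
    simp only [mem_image, mem_setOf_eq]
    constructor
    · intro hX
      obtain ⟨x, hx, hxX⟩ := hsurj (X 0) ((hP'iff _).mp hX)
      refine ⟨fun _ => x, (hPiff x).mpr hx, ?_⟩
      funext i
      rw [Fin.fin_one_eq_zero i]
      exact hxX
    · rintro ⟨p, hp, rfl⟩
      exact (hP'iff _).mpr (hinto _ ((hPiff _).mp hp))
  · -- the Jacobian identity of rule (2)
    intro p hp
    have hpP : 0 < p 0 ^ 3 + A * p 0 + B := by rw [h1] at hp; exact hp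
    have hx : ρ < p 0 := (hPiff _).mp hpP
    have hmem : (fun _ : Fin 1 => R (p 0)) ∈ r'.domain := by
      rw [h3]
      exact (hP'iff _).mpr (hinto _ hx)
    rw [h2 hp, h4 hmem, det_smul_id_fin_one]
    dsimp only
    have hgx := hgρ (p 0) hx.le
    have hSx := hSρ (p 0) hx.le
    rw [hP'R (p 0) hgx.ne']
    have hsqrt : Real.sqrt ((S.eval (p 0)) ^ 2 * (p 0 ^ 3 + A * p 0 + B) / (g.eval (p 0)) ^ 6) =
        |S.eval (p 0)| * Real.sqrt (p 0 ^ 3 + A * p 0 + B) / |g.eval (p 0)| ^ 3 := by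
      rw [Real.sqrt_div' _ (by positivity), Real.sqrt_mul (sq_nonneg _), Real.sqrt_sq_eq_abs,
        show (g.eval (p 0)) ^ 6 = ((g.eval (p 0)) ^ 3) ^ 2 by ring, Real.sqrt_sq_eq_abs, abs_pow]
    rw [hsqrt, abs_div, abs_mul, abs_pow]
    have hPsqrt : 0 < Real.sqrt (p 0 ^ 3 + A * p 0 + B) := Real.sqrt_pos.mpr hpP
    have h1' : 0 < |S.eval (p 0)| := abs_pos.mpr hSx
    have h2' : 0 < |g.eval (p 0)| := abs_pos.mpr hgx.ne'
    field_simp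


end Summit.KontsevichZagierPeriods.IsogenyCertificates.OneSheetTransfer

end
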